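import Summits.FinalStateConjecture.FinalStateConjecture.Theorems.BartnikGapSettlingBondiBartnikRigidityMarchingLemmaCollarOrientation
import Summits.FinalStateConjecture.FinalStateConjecture.Theorems.BartnikGapSettlingBondiBartnikRigidityMarchingLemmaCollarSetBasic
import Literature.Geometry.Lorentzian.CauchyDevelopment
import Literature.Geometry.Lorentzian.CausalityAchronalProofs
import HarnessLib

/-!
# K2b-5 `stub_marchingLemma`, brick 24: the boundary collar chart is time-orientation preserving on the
# collar set — line `direct-method-on-the-cone` (crux `BondiBartnikRigidity`, stmt-FinalStateConjecture-10807)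

`collar_isFutureDirected` (honesty check (ii) of the worker report, settled: no orientation clause is needed
in `IsBoundaryCollarChart`): the exact boundary collar chart `Ψ_E` (smooth and exact on the pull-back of an
open Kerr-side set `E`, image in `J⁺(C)`, continuous up to the slab — where it is `Φ₀`, `Φ₀(slab) ⊆ C ⊆ ι(X)`
— and up to the roof portion inside `O` — mapped to `∂J⁺(C)`) pushes the Kerr-star orientation `V` to
future-directed vectors at every point of the collar set `F ⊆ E`.  At a point with `r > 2M` this is
`OrientK.isFutureDirected_of_floor` with the floor segment of `CollarK.collarSet_floor` (the floor value is
on the achronal Cauchy hypersurface `ι(X) ⊇ C`, or on `∂J⁺(C)`, never in `I⁺(C)`); a point with `r ≤ 2M`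
lies in the connected low cylinder `{0 < t* < η, r < 3M} ⊆ F`, which contains points with `r = 5M/2`,
and the orientation character is constant there (`OrientK.isFutureDirected_of_isPreconnected`).

References: Dafermos–Rodnianski arXiv:0811.0354, §5.1 [DafermosRodnianski2008]; O'Neill 1983, Ch. 14,
Lemma 14.29 [ONeill1983].  No definitions, no named facts.
-/

noncomputable section

-- D-0017: single-problem summit, `Summit.<S>.<S>.…` by design (cf. lakefile `weak.linter.dupNamespace`).
set_option linter.dupNamespace false
set_option maxSynthPendingDepth 3

open Set Filter Function Topology TopologicalSpace Bundle Metric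
open Literature.Geometry.Lorentzian
open scoped Manifold ContDiff Topology ENNReal

namespace Summit.FinalStateConjecture.FinalStateConjecture.Theorems.BondiBartnikRigidity.DirectMethod

namespace OrientK

open ChartData (lab_mem_pullK_iff)
open FutureK (translate_mem_region)

variable {X : Type} [TopologicalSpace X] [ChartedSpace E3 X] [IsManifold (𝓡 3) ∞ X]
  [T2Space X] [SecondCountableTopology X] [ConnectedSpace X] {D : InitialDataSet (𝓡 3) X}

omit [T2Space X] [SecondCountableTopology X] in
/-- The slice point `(c, 0, 0)`, `c = √((5M/2)² + a²)`, has Kerr–Schild radius `5M/2`. [cite: arXiv07060622, (35)] -/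
theorem exists_radius_eq (M a : ℝ) (hM : 0 < M) : ∃ y : E3, Kerr.radius a (E4.ofTimeSpace 0 y) = 5 * M / 2 := by
  set c := Real.sqrt ((5 * M / 2) ^ 2 + a ^ 2) with hc
  set y : E3 := EuclideanSpace.single 0 c with hy
  refine ⟨y, ?_⟩
  have hsq := Kerr.radius_sq a (E4.ofTimeSpace 0 y)
  have hn : E4.spatialNorm (E4.ofTimeSpace 0 y) = |c| := by
    rw [E4.spatialNorm_ofTimeSpace, hy, PiLp.norm_single, Real.norm_eq_abs]
  have h3 : (E4.ofTimeSpace 0 y) 3 = 0 := by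
    rw [show (3 : Fin 4) = Fin.succ 2 from rfl, E4.ofTimeSpace_apply_succ, hy]
    simp
  rw [hn, h3, sq_abs] at hsq
  have hc2 : c ^ 2 = (5 * M / 2) ^ 2 + a ^ 2 := by rw [hc]; exact Real.sq_sqrt (by positivity)
  have hpos : 0 ≤ c ^ 2 - a ^ 2 := by rw [hc2]; nlinarith
  have : Kerr.radius a (E4.ofTimeSpace 0 y) ^ 2 = (5 * M / 2) ^ 2 := by
    rw [hsq]
    rw [show (c ^ 2 - a ^ 2) ^ 2 + 4 * a ^ 2 * (0 : ℝ) ^ 2 = (c ^ 2 - a ^ 2) ^ 2 by ring, Real.sqrt_sq hpos, hc2]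
    ring
  have hr := Kerr.radius_nonneg a (E4.ofTimeSpace 0 y)
  nlinarith [sq_nonneg (Kerr.radius a (E4.ofTimeSpace 0 y) - 5 * M / 2), sq_nonneg (Kerr.radius a (E4.ofTimeSpace 0 y) + 5 * M / 2)]

omit [T2Space X] [SecondCountableTopology X] in
set_option maxHeartbeats 1600000 in
/-- **The boundary collar chart is time-orientation preserving on the collar set** (see the module
docstring). [cite: DafermosRodnianski2008, §5.1] -/
theorem collar_isFutureDirected [Kerr.Facts] (𝒱 : VacuumCauchyDevelopment D)
    {M a : ℝ} (hM : 0 < M) (ha : |a| < M) {mo : lorentzGroup × E4} {B : ModelBackground}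
    (hB : B = starBackground mo.1 mo.2 M a (fun x => Kerr.radius a (poincareInv mo.1 mo.2 x)))
    {lab : Kerr.region a M → B.domain} (hlab : ∀ z, (lab z : E4) = (mo.1 : E4 ≃L[ℝ] E4) z.1 + mo.2)
    (hcyl : {y : Kerr.region a M | 0 ≤ y.1 0 ∧ Kerr.radius a y.1 ≤ 3 * M} ⊆ JK M a hM (slabK M a))
    (hfr : frontier (JK M a hM (slabK M a)) ⊆ slabK M a ∪ JK M a hM (outerSphereK M a))
    {C : Set 𝒱.carrier} {Φ₀ : B.domain → 𝒱.carrier}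
    (hCslab : Φ₀ '' pullK mo M a B (slabK M a) ⊆ C) (hCX : C ⊆ range 𝒱.embed)
    {F E O : Set (Kerr.region a M)} {w₀ η ρ : ℝ} (hη1 : η ≤ 1) (hw₀ : 2 * M + 2 ≤ w₀) (hρ : 3 / 2 * w₀ ≤ ρ)
    (hF : ∀ x : Kerr.region a M, x ∈ F ↔ x ∈ interior (JK M a hM (slabK M a)) ∧
      x.1 0 + 2 / 3 * Kerr.radius a x.1 < w₀ ∧ ∃ s, 0 < s ∧ s < η ∧
        (⟨x.1 + (-s) • E4.basisVector 0, translate_mem_region x (-s)⟩ : Kerr.region a M) ∉ JK M a hM (slabK M a))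
    (hE : IsOpen E) (hFE : F ⊆ E) (hOρ : roofK M a hM ∩ {y | Kerr.radius a y.1 ≤ ρ} ⊆ O)
    {ΨE : B.domain → 𝒱.carrier}
    (hs : ContMDiffOn 𝓘(ℝ, E4) (𝓡 4) ∞ ΨE (pullK mo M a B E))
    (himg : ΨE '' pullK mo M a B E ⊆ 𝒱.metric.causalFuture 𝒱.timeOrientation C)
    (hd : supCkENorm (Subtype.val '' pullK mo M a B E) 0 (𝒱.toSpacetime.deviationExtend B ΨE) ≤ 0)
    (hcont : ContinuousOn ΨE (pullK mo M a B (E ∪ slabK M a ∪ (O ∩ roofK M a hM))))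
    (hroof : ΨE '' pullK mo M a B (O ∩ roofK M a hM) ⊆ frontier (𝒱.metric.causalFuture 𝒱.timeOrientation C))
    (hslab : ∀ x ∈ pullK mo M a B (slabK M a), ΨE x = Φ₀ x) :
    ∀ z ∈ F, 𝒱.timeOrientation.IsFutureDirected (mfderiv 𝓘(ℝ, E4) (𝓡 4) (ΨE ∘ lab) z (Kerr.timeVector M a z.1)) := by
  have hn1 : (1 : ℕ∞ω) ≤ (∞ : ℕ∞ω) := by exact_mod_cast le_top
  have hn2 : (2 : ℕ∞ω) ≤ (∞ : ℕ∞ω) := WithTop.coe_le_coe.mpr le_top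
  set W := interior (JK M a hM (slabK M a)) with hWdef
  have hJc := FutureK.isClosed_JK_slabK hM hfr
  have hW0 : ∀ x ∈ W, 0 < x.1 0 := fun x hx => FutureK.interior_JK_slabK_pos hM ha hx
  have hWr : ∀ x ∈ W, 2 * Kerr.radius a x.1 ≤ 6 * M + 3 * x.1 0 := fun x hx =>
    (FrontierK.JK_slabK_subset hM ha (interior_subset hx)).2
  -- `I⁺(C)` misses `C ⊆ ι(X)` (achronality) and `∂J⁺(C)` (openness)
  have hnotI_C : ∀ e ∈ C, e ∉ 𝒱.metric.chronologicalFuture 𝒱.timeOrientation C := by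
    rintro e he ⟨p, hp, hI⟩
    exact LorentzianMetric.IsCauchyHypersurface.isAchronal_holds hn2 𝒱.isCauchyHypersurface p (hCX hp) e (hCX he) ⟨p, mem_singleton p, hI⟩
  have hnotI_fr : ∀ e ∈ frontier (𝒱.metric.causalFuture 𝒱.timeOrientation C),
      e ∉ 𝒱.metric.chronologicalFuture 𝒱.timeOrientation C := by
    intro e he hI
    have hint : e ∈ interior (𝒱.metric.causalFuture 𝒱.timeOrientation C) :=
      interior_maximal (LorentzianMetric.chronologicalFuture_subset_causalFuture _ _ _)
        (LorentzianMetric.isOpen_chronologicalFuture_of_boundaryless _ _ _) hI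
    exact (disjoint_interior_frontier (s := 𝒱.metric.causalFuture 𝒱.timeOrientation C)).le_bot ⟨hint, he⟩
  /- ### Case A: points with `r > 2M` -/
  have caseA : ∀ z ∈ F, 2 * M < Kerr.radius a z.1 →
      𝒱.timeOrientation.IsFutureDirected (mfderiv 𝓘(ℝ, E4) (𝓡 4) (ΨE ∘ lab) z (Kerr.timeVector M a z.1)) := by
    intro z hzF hr
    obtain ⟨hzW, hzw, -⟩ := (hF z).1 hzF
    obtain ⟨s', hs'0, hs'η, hseg, hfront⟩ := CollarK.collarSet_floor hM ha hcyl hfr hF hzF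
    set T : ℝ → Kerr.region a M := fun u => ⟨z.1 + (-u) • E4.basisVector 0, translate_mem_region z (-u)⟩ with hT
    have hT0 : T 0 = z := Subtype.ext (by simp [hT])
    -- `s' > 0` (the point itself is interior)
    have hs'pos : 0 < s' := by
      rcases hs'0.lt_or_eq with h | h
      · exact h
      · exfalso
        have : T s' = z := by rw [← h]; exact hT0
        have hzfr : z ∈ frontier (JK M a hM (slabK M a)) := this ▸ hfront
        exact (disjoint_interior_frontier (s := JK M a hM (slabK M a))).le_bot ⟨hzW, hzfr⟩
    -- the floor point and the continuity of `ΨE` there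
    set zf := T s' with hzf
    have hzfr : Kerr.radius a zf.1 = Kerr.radius a z.1 := Kerr.radius_add_time_smul_basisVector a z.1 _
    have hzfE : zf ∈ E ∪ slabK M a ∪ (O ∩ roofK M a hM) := by
      rcases hfr hfront with h | h
      · exact Or.inl (Or.inr h)
      · have hroofK : zf ∈ roofK M a hM := ⟨hfront, h⟩
        refine Or.inr ⟨hOρ ⟨hroofK, ?_⟩, hroofK⟩
        show Kerr.radius a zf.1 ≤ ρ
        rw [hzfr]; nlinarith [Kerr.radius_nonneg a z.1, hW0 z hzW]
    have hcurve_c : Continuous fun u : ℝ => lab (T u) :=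
      (ChartData.contMDiff_lab hlab).1.continuous.comp (CollarK.continuous_translate.comp (continuous_neg.prodMk continuous_const))
    have htend : Tendsto (fun u => lab (T u)) (𝓝[<] s') (𝓝[pullK mo M a B (E ∪ slabK M a ∪ (O ∩ roofK M a hM))] (lab zf)) := by
      refine tendsto_nhdsWithin_iff.2 ⟨(hcurve_c.tendsto s').mono_left nhdsWithin_le_nhds, ?_⟩
      filter_upwards [Ioo_mem_nhdsLT hs'pos] with u hu
      exact (lab_mem_pullK_iff hlab _).2 (Or.inl (Or.inl (hFE (hseg u hu.1.le hu.2))))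
    have hcontz : Tendsto (fun u => ΨE (lab (T u))) (𝓝[<] s') (𝓝 (ΨE (lab zf))) :=
      (hcont (lab zf) ((lab_mem_pullK_iff hlab _).2 hzfE)).tendsto.comp htend
    -- the floor value is not in `I⁺(C)`
    have he : ΨE (lab zf) ∉ 𝒱.metric.chronologicalFuture 𝒱.timeOrientation C := by
      rcases hfr hfront with h | h
      · have hx : lab zf ∈ pullK mo M a B (slabK M a) := (lab_mem_pullK_iff hlab _).2 h
        rw [hslab _ hx]
        exact hnotI_C _ (hCslab ⟨lab zf, hx, rfl⟩)
      · have hroofK : zf ∈ roofK M a hM := ⟨hfront, h⟩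
        have hzfO : zf ∈ O := hOρ ⟨hroofK, by show Kerr.radius a zf.1 ≤ ρ; rw [hzfr]; nlinarith [Kerr.radius_nonneg a z.1, hW0 z hzW]⟩
        exact hnotI_fr _ (hroof ⟨lab zf, (lab_mem_pullK_iff hlab _).2 ⟨hzfO, hroofK⟩, rfl⟩)
    exact isFutureDirected_of_floor (𝒮 := 𝒱.toSpacetime) hM hlab hE hB hs hd himg hr hs'pos
      (fun u hu0 hus => hFE (hseg u hu0 hus)) hcontz he
  /- ### Case B: inner points, through the connected low cylinder -/
  intro z hzF
  by_cases hr : 2 * M < Kerr.radius a z.1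
  · exact caseA z hzF hr
  push Not at hr
  obtain ⟨hzW, hzw, -⟩ := (hF z).1 hzF
  obtain ⟨s', hs'0, hs'η, -, hfront⟩ := CollarK.collarSet_floor hM ha hcyl hfr hF hzF
  -- the floor is the slab: `t*(z) = s' < η`
  have hzt : z.1 0 < η := by
    rcases hfr hfront with h | h
    · have : (z.1 + (-s') • E4.basisVector 0) 0 = 0 := h.1
      simp [E4.basisVector] at this; linarith
    · have h3 := CollarK.radius_ge_of_mem_roofK hM ha hcyl ⟨hfront, h⟩
      have : Kerr.radius a (z.1 + (-s') • E4.basisVector 0) = Kerr.radius a z.1 := Kerr.radius_add_time_smul_basisVector a z.1 _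
      rw [this] at h3; linarith
  -- the low cylinder lies in `F`
  set A : Set (Kerr.region a M) := {y | 0 < y.1 0 ∧ y.1 0 < η ∧ Kerr.radius a y.1 < 3 * M} with hA
  have hAW : A ⊆ W := by
    intro y hy
    have hO : IsOpen {y : Kerr.region a M | 0 < y.1 0 ∧ Kerr.radius a y.1 < 3 * M} :=
      (isOpen_lt continuous_const (K2Route.continuous_tstar a M)).inter
        (isOpen_lt (K2Route.continuous_radius_region a M) continuous_const)
    exact interior_maximal (fun y hy => hcyl ⟨hy.1.le, hy.2.le⟩) hO ⟨hy.1, hy.2.2⟩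
  have hAF : A ⊆ F := fun y hy =>
    CollarK.low_mem_collarSet hM ha hF (hAW hy) hy.2.1 (by nlinarith [hy.2.2, hy.2.1])
  have hzA : z ∈ A := ⟨hW0 z hzW, hzt, by linarith⟩
  -- a point of the cylinder with `r = 5M/2`
  obtain ⟨y₁, hy₁⟩ := exists_radius_eq M a hM
  have hmax' : max M 0 = M := max_eq_left hM.le
  have hreg₁ : E4.ofTimeSpace (z.1 0) y₁ ∈ Kerr.region a M := by
    rw [Kerr.mem_region, hmax', Kerr.radius_eq_of_spatial_eq a (y := E4.ofTimeSpace 0 y₁)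
      (by rw [E4.spatial_ofTimeSpace, E4.spatial_ofTimeSpace]), hy₁]; linarith
  set z₁ : Kerr.region a M := ⟨E4.ofTimeSpace (z.1 0) y₁, hreg₁⟩ with hz₁
  have hz₁r : Kerr.radius a z₁.1 = 5 * M / 2 := by
    rw [hz₁]; show Kerr.radius a (E4.ofTimeSpace (z.1 0) y₁) = _
    rw [Kerr.radius_eq_of_spatial_eq a (y := E4.ofTimeSpace 0 y₁) (by rw [E4.spatial_ofTimeSpace, E4.spatial_ofTimeSpace]), hy₁]
  have hz₁A : z₁ ∈ A := ⟨by show 0 < (E4.ofTimeSpace (z.1 0) y₁) 0; rw [E4.ofTimeSpace_apply_zero]; exact hW0 z hzW,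
    by show (E4.ofTimeSpace (z.1 0) y₁) 0 < η; rw [E4.ofTimeSpace_apply_zero]; exact hzt, by rw [hz₁r]; linarith⟩
  have h₁ := caseA z₁ (hAF hz₁A) (by rw [hz₁r]; linarith)
  exact isFutureDirected_of_isPreconnected (𝒮 := 𝒱.toSpacetime) hM hlab hE hB hs hd (isPreconnected_lowCylinder hM η)
    (hAF.trans hFE) hz₁A h₁ hzA

end OrientK

/-- **Registered bookkeeping sub-goal `stub_kerrExistsRadiusEq` of the line** (brick of the landing of
K2b-5 `stub_marchingLemma`): the Kerr–Schild slice contains a point of radius `5M/2` (anchor of this file,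
whose content is the forced orientation of the boundary collar chart on the collar set,
`OrientK.collar_isFutureDirected`). [cite: arXiv07060622, (35)] -/
theorem stub_kerrExistsRadiusEq : ∀ (M a : ℝ), 0 < M → ∃ y : E3, Kerr.radius a (E4.ofTimeSpace 0 y) = 5 * M / 2 :=
  fun M a hM => OrientK.exists_radius_eq M a hM

end Summit.FinalStateConjecture.FinalStateConjecture.Theorems.BondiBartnikRigidity.DirectMethod

end
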